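/-
Copyright (c) 2026 the pub-hodgecm-mathlib formalisation cell (harness21).  Prover seat hodgecm-mathlib-K2Liu-p01 (g5): Track B «K2-LIT»,
#184♮ = hLiu418 = stmt-HodgeConjecture-24832, road `K2_Liu`, socket #41, ROAD Φ organ Φ8a (B) «modulus of `P_Δ(F_v)` on `N_Δ(F_v)`», brick 3, and Φ8a (C).
-/
import Summits.HodgeConjecture.HodgeConjecture.Theorems.K2LiuSkewConjugationHaarChar     -- ★ Φ8a (B) brick 2: `addEquivAddHaarChar_skew_conj`, `isClosed_skew`
import Summits.HodgeConjecture.HodgeConjecture.Theorems.K2LiuUnipDeltaRankOneHaar          -- ★ `continuous_matS`, `continuous_blkB_matA` (any rank)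
import HarnessLib

/-!
# Crux `HLiu418`, road `K2_Liu`, socket #41, organ Φ8a (B) brick 3 and (C): THE MODULUS OF `P_Δ(F_v)` ON `N_Δ(F_v)` IS `|det_Δ|_v^{n}`, and
# THE LOCAL INTERTWINING PROPERTY `M_v(s) : I_v(s, χ_v) → I_v(−s, (χ_v ∘ c)⁻¹)` (unconditional)

Cell `hodgecm-mathlib`, crux item hLiu418 = `stmt-HodgeConjecture-24832`; squad K2 ∕ K2Liu; prover K2Liu-p01 (g5).  THEOREMS ONLY (no `def`,
no `instance`, no notation, no named-fact hypothesis, no `sorry`); lane `--supports stmt-HodgeConjecture-24832` (count-neutral helper).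

THE MATHEMATICS ([WeilBNT1967, Ch. I §2]; [HarrisKudlaSweet1996, §1 (1.11)–(1.15), §6 (6.14)]; [Casselman1980, §3]; [MoeglinWaldspurger1995, II.1.6]).
`Skew = {t ∈ M_n(E ⊗ F_v) : σ(t)ᵀ T + T t = 0} ≅ N_Δ(F_v)` (`t ↦ n(t)`, ★ `nElem`), and `Ad(q)` (`q ∈ P_Δ(F_v)`, adapted blocks `A, D`) acts by `t ↦ A t D⁻¹`
(★ `blkB_matA_conj_nElem`) with module `|det_Δ q|_v^{n}` on `Skew` (★ brick 2 `K2LiuSkewConjugationHaarChar.addEquivAddHaarChar_skew_conj`).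
* §3 HAAR TRANSPORT: `map_eq_addEquivAddHaarChar_inv_smul_of_semiconj` (generic: a homeomorphism `ψ : N ≃ S` onto a second countable locally compact additive
  group turning `·` into `+` and intertwining `θ` with `L : S ≃ₜ+ S` gives `θ_* νN = χ(L)⁻¹ • νN` for every Haar `νN`); `N_Δ(F_v) ≃ₜ Skew` (`u ↦ B(u)`, inverse
  `t ↦ n(t)`, continuity as in ★ `K2LiuUnipDeltaRankOneHaar.continuous_nElem_coord`, any rank); and **`map_conj_unipDeltaLocal_eq_smul`**: for every Haar measure
  `νN` on `N_Δ(F_v)` and `q ∈ P_Δ(F_v)`, `(u ↦ q u q⁻¹)_* νN = |det_Δ q|_v^{−n} • νN` — the hypothesis `hmod` of ★ Φ8a (A).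
* §4 **`isLocalSiegelSection_localIntertwining`** — THE LOCAL INTERTWINING PROPERTY, unconditional: for `νN` Haar on `N_Δ(F_v)`, `f ∈ I_v(s, χ_v)` a Siegel section
  and `χ′_w = (χ_{w′})⁻¹ ∘ c_w` (`χ′ = (χ ∘ c)⁻¹`), `M_v f = localIntertwining νN f` is a Siegel section of `I_v(−s, χ′_v)` (★ Φ8a (A)
  `K2LiuLocalIntertwiningProperty.isLocalSiegelSection_localIntertwining_of_modulus` + §3); in particular the hypothesis `hM` of ★
  `K2LiuLocalIntertwiningSphericalReduction.localIntertwining_eq_apply_one_mul` holds with `s′ = −s`.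
HONEST LABEL.  Count-neutral helper; it retires nothing by itself: `HC_CM` is proved only modulo the 7 printed citations (2 remaining named inputs:
hLiu418 = `stmt-HodgeConjecture-24832`, h413 = `stmt-HodgeConjecture-24833`) until rung 0 closes.

## References
* [WeilBNT1967] A. Weil, *Basic Number Theory* (1967): Ch. I §2 (module of an automorphism; Prop. 2 Cor. 3; products).
* [Weil1965] A. Weil, *L'intégration dans les groupes topologiques* (2nd ed. 1965): §37 (Haar transport along isomorphisms).
* [HarrisKudlaSweet1996] M. Harris, S. Kudla, W. J. Sweet, J. AMS 9 (1996): §1 (1.11)–(1.15), §6 (6.14) (`M(s) : I_n(s, χ) → I_n(−s, (χ∘c)⁻¹)`).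
* [Casselman1980] W. Casselman, Compositio Math. 40 (1980): §3.   * [MoeglinWaldspurger1995] C. Mœglin, J.-L. Waldspurger, CUP (1995): II.1.6.
-/

set_option autoImplicit false
set_option linter.dupNamespace false -- the mandated namespace repeats `HodgeConjecture.HodgeConjecture`

noncomputable section

open NumberField IsDedekindDomain Matrix MeasureTheory MeasureTheory.Measure Topology
open scoped NNReal ENNReal
open Literature.NumberTheory.GaloisRepresentations.IsNonarchimedeanLocalField
open Literature.NumberTheory.Automorphic Literature.NumberTheory.Automorphic.UnitaryGroup
open Literature.NumberTheory.GelbartRogawski1991.AdaptedBlocks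
open Literature.NumberTheory.GelbartRogawski1991.UnitaryDualPair.LocalSplitting
open Literature.NumberTheory.K2Lit.LocalSiegelDoubled
open Literature.MeasureTheory.Group
open Summit.HodgeConjecture.HodgeConjecture.Cruxes.H413.K2E5HaarCharProduct
open Summit.HodgeConjecture.HodgeConjecture.Cruxes.HLiu418.K2LiuSiegelLeviWeylAlgebra
open Summit.HodgeConjecture.HodgeConjecture.Cruxes.HLiu418.K2LiuUnipDeltaLocalCoordinates
open Summit.HodgeConjecture.HodgeConjecture.Cruxes.HLiu418.K2LiuLocalSiegel
open Summit.HodgeConjecture.HodgeConjecture.Cruxes.HLiu418.K2LiuLocalIntertwiningProperty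
open Summit.HodgeConjecture.HodgeConjecture.Cruxes.HLiu418.K2LiuLocalMatrixHaarChar
open Summit.HodgeConjecture.HodgeConjecture.Cruxes.HLiu418.K2LiuUnipDeltaRankOneHaar
open Summit.HodgeConjecture.HodgeConjecture.Cruxes.HLiu418.K2LiuSkewConjugationHaarChar

namespace Summit.HodgeConjecture.HodgeConjecture.Cruxes.HLiu418.K2LiuUnipDeltaConjugationModulus

variable (F : Type) [Field F] [NumberField F] (E : Type) [Field E] [NumberField E] [Algebra F E]
  [Algebra.IsQuadraticExtension F E] (c : E ≃ₐ[F] E)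
  {δ : E} (hcδ : c δ = -δ) (hδ : δ ≠ 0) {d : F} (hd : δ * δ = algebraMap F E d)
  (v : HeightOneSpectrum (𝓞 F)) (n : ℕ) {T₀ : Matrix (Fin n) (Fin n) F} (hT₀ : T₀.IsSymm) (hT₀d : IsUnit T₀.det)
  {JD : Matrix (Fin (n + n)) (Fin (n + n)) E} (hJD : JD = (gramD F n T₀).map (algebraMap F E))

/-! ## §3 Haar transport `N_Δ(F_v) ≃ₜ Skew` and the modulus `(u ↦ q u q⁻¹)_* νN = |det_Δ q|_v^{−n} • νN` -/

omit [Algebra.IsQuadraticExtension F E] in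
include hJD in
/-- the matrix of `n(t)` over `E ⊗ F_v` is `reindex (R (1 t; 0 1) R⁻¹)` (any rank; ★ `matS_nElem` is the rank-one case). [cite: Kudla1994, §3] -/
theorem matS_nElem' {t : Matrix (Fin n) (Fin n) (LocalRing E v)}
    (ht : (t.map (conjLocal E c v))ᵀ * gramS F E v n T₀ + gramS F E v n T₀ * t = 0) :
    matS F E c v n (nElem F E c v n hJD t ht) =
      Matrix.reindex (e₂ n) (e₂ n) (cayR (LocalRing E v) (Fin n) * Matrix.fromBlocks 1 t 0 1 * cayRinv (LocalRing E v) (Fin n)) := by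
  rw [← reindex_matA]
  unfold nElem
  rw [matA_ofAdapted]

omit [Algebra.IsQuadraticExtension F E] in
include hJD in
/-- **`t ↦ n(t)` is continuous `Skew → N_Δ(F_v)`** (matrix and inverse matrix are affine in `t`; the any-rank twin of ★ `continuous_nElem_coord`).
[cite: Weil1965, §37] -/
theorem continuous_nElem_skew (S : AddSubgroup (Matrix (Fin n) (Fin n) (LocalRing E v)))
    (hS : ∀ t, t ∈ S ↔ (t.map (conjLocal E c v))ᵀ * gramS F E v n T₀ + gramS F E v n T₀ * t = 0) :
    Continuous fun t : S => (⟨nElem F E c v n hJD t.1 ((hS t.1).1 t.2), nElem_mem_unipDeltaLocal F E c v n hJD t.1 ((hS t.1).1 t.2)⟩ :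
      unipDeltaLocal F E c v n (JD := JD)) := by
  have hre : ∀ f : S → Matrix (Fin n) (Fin n) (LocalRing E v), Continuous f → Continuous fun t : S =>
      Matrix.reindex (e₂ n) (e₂ n) (cayR (LocalRing E v) (Fin n) * Matrix.fromBlocks 1 (f t) 0 1 * cayRinv (LocalRing E v) (Fin n)) :=
    fun f hf => ((continuous_const.matrix_mul (Continuous.matrix_fromBlocks continuous_const hf continuous_const continuous_const)).matrix_mul
      continuous_const).matrix_reindex _ _
  refine Continuous.subtype_mk ?_ _
  rw [← (localPiEquiv E c (n + n) JD v).toHomeomorph.comp_continuous_iff]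
  refine continuous_induced_rng.2 (Units.continuous_iff.2 ⟨?_, ?_⟩)
  · show Continuous fun t : S => matS F E c v n (nElem F E c v n hJD t.1 ((hS t.1).1 t.2))
    simp only [matS_nElem' F E c v n hJD]
    exact hre _ continuous_subtype_val
  · have h : (fun t : S => Units.val ((localPiEquiv E c (n + n) JD v (nElem F E c v n hJD t.1 ((hS t.1).1 t.2))).1⁻¹)) =
        fun t => Matrix.reindex (e₂ n) (e₂ n) (cayR (LocalRing E v) (Fin n) * Matrix.fromBlocks 1 (-t.1) 0 1 * cayRinv (LocalRing E v) (Fin n)) := by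
      funext t
      rw [← Subgroup.coe_inv, ← map_inv, nElem_inv]
      show matS F E c v n _ = _
      rw [matS_nElem']
    show Continuous fun t : S => Units.val ((localPiEquiv E c (n + n) JD v (nElem F E c v n hJD t.1 ((hS t.1).1 t.2))).1⁻¹)
    rw [h]
    exact hre _ continuous_subtype_val.neg

omit [Algebra.IsQuadraticExtension F E] in
include hJD in
/-- **`N_Δ(F_v) ≃ₜ Skew`, `u ↦ B(u)`** (inverse `t ↦ n(t)`), turning products into sums; for any additive subgroup `S` with `S = Skew` as a set (the any-rank twin of ★
`K2LiuUnipDeltaRankOneHaar.exists_homeomorph_coord`). [cite: HarrisKudlaSweet1996, §1 (1.11)–(1.12)] [cite: Weil1965, §37] -/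
theorem exists_homeomorph_skew (S : AddSubgroup (Matrix (Fin n) (Fin n) (LocalRing E v)))
    (hS : ∀ t, t ∈ S ↔ (t.map (conjLocal E c v))ᵀ * gramS F E v n T₀ + gramS F E v n T₀ * t = 0) :
    ∃ ψ : unipDeltaLocal F E c v n (JD := JD) ≃ₜ S,
      (∀ u, (ψ u).1 = blkB (matA F E c v n (u : UnitaryGroup.localPi E c (n + n) JD v))) ∧ (∀ u u', ψ (u * u') = ψ u + ψ u') := by
  refine ⟨⟨⟨fun u => ⟨blkB (matA F E c v n (u : UnitaryGroup.localPi E c (n + n) JD v)), (hS _).2 (skew_blkB_of_mem_unipDeltaLocal F E c v n hJD u.2)⟩,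
    fun t => ⟨nElem F E c v n hJD t.1 ((hS t.1).1 t.2), nElem_mem_unipDeltaLocal F E c v n hJD t.1 ((hS t.1).1 t.2)⟩,
    fun u => Subtype.ext (eq_nElem_of_mem_unipDeltaLocal F E c v n hJD u.2).symm, fun t => Subtype.ext (blkB_matA_nElem F E c v n hJD ((hS t.1).1 t.2))⟩,
    ((continuous_blkB_matA F E c v n).comp continuous_subtype_val).subtype_mk _, continuous_nElem_skew F E c v n hJD S hS⟩,
    fun u => rfl, fun u u' => Subtype.ext ?_⟩
  show blkB (matA F E c v n ((u : UnitaryGroup.localPi E c (n + n) JD v) * (u' : UnitaryGroup.localPi E c (n + n) JD v))) =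
    blkB (matA F E c v n (u : UnitaryGroup.localPi E c (n + n) JD v)) + blkB (matA F E c v n (u' : UnitaryGroup.localPi E c (n + n) JD v))
  conv_lhs => rw [eq_nElem_of_mem_unipDeltaLocal F E c v n hJD u.2, eq_nElem_of_mem_unipDeltaLocal F E c v n hJD u'.2,
    ← nElem_add F E c v n hJD, blkB_matA_nElem]

/-- **Haar transport of a module** (generic): if a homeomorphism `ψ : N ≃ S` from a topological group onto a second countable locally compact
additive group turns products into sums and intertwines `θ : N → N` with a bi-continuous additive automorphism `L` of `S`, then for every Haar measure
`νN` on `N`, `θ_* νN = χ(L)⁻¹ • νN` (`χ` = Mathlib `addEquivAddHaarChar`; the image `ψ_* νN` is a regular additive Haar measure on `S`, and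
`θ = ψ⁻¹ ∘ L ∘ ψ`). [cite: WeilBNT1967, Ch. I §2] [cite: Weil1965, §37] -/
theorem map_eq_addEquivAddHaarChar_inv_smul_of_semiconj {N : Type*} [Group N] [TopologicalSpace N] [IsTopologicalGroup N] [MeasurableSpace N]
    [BorelSpace N] {S : Type*} [AddCommGroup S] [TopologicalSpace S] [IsTopologicalAddGroup S] [MeasurableSpace S] [BorelSpace S]
    [LocallyCompactSpace S] [SecondCountableTopology S] [T2Space S]
    (ψ : N ≃ₜ S) (hψ : ∀ u u', ψ (u * u') = ψ u + ψ u') (L : S ≃ₜ+ S) (θ : N → N) (hθ : ∀ u, ψ (θ u) = L (ψ u))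
    (νN : Measure N) [νN.IsHaarMeasure] :
    Measure.map θ νN = (addEquivAddHaarChar L)⁻¹ • νN := by
  -- `μ = ψ_* νN` is a regular additive Haar measure on `S`
  set μ : Measure S := Measure.map ψ νN with hμ
  have hνK : ∀ K : Set N, IsCompact K → νN K < ⊤ := fun K hK => hK.measure_lt_top
  have hψK : ∀ K : Set S, IsCompact K → IsCompact ((ψ : N → S) ⁻¹' K) := fun K hK => ψ.isCompact_preimage.2 hK
  have hfin : ∀ K : Set S, IsCompact K → μ K < ⊤ := fun K hK => by
    rw [hμ, Measure.map_apply ψ.measurable hK.measurableSet]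
    exact hνK _ (hψK K hK)
  haveI : IsFiniteMeasureOnCompacts μ := ⟨fun K hK => hfin K hK⟩
  haveI : μ.IsOpenPosMeasure := ⟨fun U hU hne => by
    rw [hμ, Measure.map_apply ψ.measurable hU.measurableSet]
    exact (hU.preimage ψ.continuous).measure_ne_zero νN (hne.preimage ψ.surjective)⟩
  haveI : μ.IsAddLeftInvariant := ⟨fun t => by
    have hadd : Measurable fun x : S => t + x := (continuous_const.add continuous_id).measurable
    have hmul : Measurable fun u : N => ψ.symm t * u := (continuous_const.mul continuous_id).measurable
    rw [hμ, Measure.map_map hadd ψ.measurable]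
    have hcomp : ((fun x : S => t + x) ∘ ψ) = (ψ ∘ fun u => ψ.symm t * u) := by
      funext u
      simp only [Function.comp_apply]
      rw [hψ, ψ.apply_symm_apply]
    rw [hcomp, ← Measure.map_map ψ.measurable hmul, map_mul_left_eq_self νN (ψ.symm t)]⟩
  haveI : μ.IsAddHaarMeasure :=
    { toIsFiniteMeasureOnCompacts := inferInstance, toIsAddLeftInvariant := inferInstance, toIsOpenPosMeasure := inferInstance }
  haveI : μ.Regular := by
    obtain ⟨K⟩ := (inferInstance : Nonempty (TopologicalSpace.PositiveCompacts S))
    exact regular_of_isAddLeftInvariant K.isCompact K.interior_nonempty K.isCompact.measure_lt_top.ne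
  have hmapL : μ.map L = (addEquivAddHaarChar L)⁻¹ • μ := map_eq_addEquivAddHaarChar_inv_smul μ L
  -- `θ = ψ⁻¹ ∘ L ∘ ψ`
  have hfun : θ = ψ.symm ∘ L ∘ ψ := by
    funext u
    rw [Function.comp_apply, Function.comp_apply, ← hθ, ψ.symm_apply_apply]
  rw [hfun, ← Measure.map_map ψ.symm.measurable ((map_continuous L).measurable.comp ψ.measurable),
    ← Measure.map_map (map_continuous L).measurable ψ.measurable, ← hμ, hmapL]
  ext s hs
  have hpre : (ψ : N → S) ⁻¹' ((ψ.symm : S → N) ⁻¹' s) = s := by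
    ext u
    simp only [Set.mem_preimage, Homeomorph.symm_apply_apply]
  rw [Measure.map_apply ψ.symm.measurable hs, Measure.smul_apply, Measure.smul_apply, hμ,
    Measure.map_apply ψ.measurable (ψ.symm.measurable hs), hpre]

include hcδ hδ hd hT₀ hT₀d hJD in
/-- **THE MODULUS OF `P_Δ(F_v)` ON `N_Δ(F_v)`**: for every Haar measure `νN` on `N_Δ(F_v)` and `q ∈ P_Δ(F_v)`,
`(u ↦ q u q⁻¹)_* νN = |det_Δ q|_v^{−n} • νN` (`|det_Δ q|_v = Π_{w ∣ v} ‖det_Δ q_w‖_w`, ★ `absDetDelta`) — i.e. `νN(q S q⁻¹) = |det_Δ q|_v^{n} νN(S)`,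
the classical `δ_{P}(m n) = |det a|_E^{n}` of the Siegel parabolic of `U(n, n)`; this is the hypothesis `hmod` of ★ Φ8a (A).  Transport along `N_Δ(F_v) ≃ₜ Skew`
(`u ↦ B(u)`; the image of `νN` is an additive Haar measure on `Skew`), where the conjugation becomes `t ↦ A t D⁻¹` with module `|det_Δ q|_v^{n}` (§2).
[cite: HarrisKudlaSweet1996, §1 (1.12), (1.15)] [cite: Casselman1980, §3] [cite: WeilBNT1967, Ch. I §2] -/
theorem map_conj_unipDeltaLocal_eq_smul [MeasurableSpace (unipDeltaLocal F E c v n (JD := JD))] [BorelSpace (unipDeltaLocal F E c v n (JD := JD))]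
    (νN : Measure (unipDeltaLocal F E c v n (JD := JD))) [νN.IsHaarMeasure]
    {q : UnitaryGroup.localPi E c (n + n) JD v} (hq : IsSiegelDelta F E c hcδ hδ hd v n hT₀ hJD q) :
    Measure.map (fun u : unipDeltaLocal F E c v n (JD := JD) =>
      (⟨q * (u : UnitaryGroup.localPi E c (n + n) JD v) * q⁻¹, conj_mem_unipDeltaLocal F E c hcδ hδ hd v n hT₀ hJD hq u.2⟩ :
        unipDeltaLocal F E c v n (JD := JD))) νN =
      ENNReal.ofReal ((absDetDelta F E c v n q ^ n)⁻¹) • νN := by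
  -- topology on `M_n(E ⊗ F_v)`
  haveI : SecondCountableTopology (Matrix (Fin n) (Fin n) (LocalRing E v)) := secondCountableTopology_matrix_localRing F E v n
  haveI : LocallyCompactSpace (Matrix (Fin n) (Fin n) (LocalRing E v)) := locallyCompactSpace_matrix_localRing F E v n
  have hC := (isSiegelDelta_iff_blkC_eq_zero F E c hcδ hδ hd v n hT₀ hJD q).1 hq
  -- the additive group `Skew` with its Borel structure
  obtain ⟨S, hS⟩ : ∃ S : AddSubgroup (Matrix (Fin n) (Fin n) (LocalRing E v)),
      ∀ t, t ∈ S ↔ (t.map (conjLocal E c v))ᵀ * gramS F E v n T₀ + gramS F E v n T₀ * t = 0 :=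
    ⟨{ carrier := {t | (t.map (conjLocal E c v))ᵀ * gramS F E v n T₀ + gramS F E v n T₀ * t = 0}
       add_mem' := fun ht ht' => skew_add F E c v n ht ht'
       zero_mem' := skew_zero F E c v n
       neg_mem' := fun ht => skew_neg F E c v n ht }, fun t => Iff.rfl⟩
  haveI : LocallyCompactSpace S := (isClosed_skew F E c v n S hS).isClosedEmbedding_subtypeVal.locallyCompactSpace
  haveI : SecondCountableTopology S := TopologicalSpace.Subtype.secondCountableTopology _
  obtain ⟨mS, hmS⟩ : ∃ m : MeasurableSpace S, @BorelSpace S _ m := ⟨borel _, @BorelSpace.mk _ _ (borel _) rfl⟩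
  letI : MeasurableSpace S := mS
  haveI : BorelSpace S := hmS
  -- the transport `ψ : N_Δ(F_v) ≃ₜ Skew`, the conjugation `e`, and the induced additive automorphism `L` of `Skew`
  obtain ⟨ψ, hψ, hψmul⟩ := exists_homeomorph_skew F E c v n hJD S hS
  obtain ⟨e, he⟩ := exists_homeomorph_conj F E c hcδ hδ hd v n hT₀ hJD hq
  have hemul : ∀ u u', e (u * u') = e u * e u' := fun u u' => Subtype.ext (by
    rw [he, he, he]
    show q * ((u : UnitaryGroup.localPi E c (n + n) JD v) * (u' : UnitaryGroup.localPi E c (n + n) JD v)) * q⁻¹ =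
      q * (u : UnitaryGroup.localPi E c (n + n) JD v) * q⁻¹ * (q * (u' : UnitaryGroup.localPi E c (n + n) JD v) * q⁻¹)
    group)
  have hψsymm_add : ∀ s s' : S, ψ.symm (s + s') = ψ.symm s * ψ.symm s' := fun s s' =>
    ψ.injective (by rw [ψ.apply_symm_apply, hψmul, ψ.apply_symm_apply, ψ.apply_symm_apply])
  obtain ⟨L, hLapply⟩ : ∃ L : S ≃ₜ+ S, ∀ t, L t = ψ (e (ψ.symm t)) :=
    ⟨⟨⟨⟨fun t => ψ (e (ψ.symm t)), fun t => ψ (e.symm (ψ.symm t)),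
        fun t => by simp only [Homeomorph.symm_apply_apply, Homeomorph.apply_symm_apply],
        fun t => by simp only [Homeomorph.symm_apply_apply, Homeomorph.apply_symm_apply]⟩,
      fun t t' => by
        show ψ (e (ψ.symm (t + t'))) = ψ (e (ψ.symm t)) + ψ (e (ψ.symm t'))
        rw [hψsymm_add, hemul, hψmul]⟩,
      ψ.continuous.comp (e.continuous.comp ψ.symm.continuous), ψ.continuous.comp (e.symm.continuous.comp ψ.symm.continuous)⟩,
      fun t => rfl⟩
  have hL : ∀ t : S, (L t).1 = blkA (matA F E c v n q) * t.1 * (blkD (matA F E c v n q))⁻¹ := fun t => by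
    have ht1 : blkB (matA F E c v n (ψ.symm t : UnitaryGroup.localPi E c (n + n) JD v)) = t.1 := by
      have h := hψ (ψ.symm t)
      rw [ψ.apply_symm_apply] at h
      exact h.symm
    rw [hLapply, hψ, he]
    show blkB (matA F E c v n (q * (ψ.symm t : UnitaryGroup.localPi E c (n + n) JD v) * q⁻¹)) = _
    conv_lhs => rw [eq_nElem_of_mem_unipDeltaLocal F E c v n hJD (ψ.symm t).2]
    rw [blkB_matA_conj_nElem F E c v n hJD hC, ht1]
  have hχ : ((addEquivAddHaarChar L : ℝ≥0) : ℝ) = absDetDelta F E c v n q ^ n :=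
    addEquivAddHaarChar_skew_conj F E c hcδ hδ hd v n hT₀ hT₀d hJD S hS hq L hL
  -- Haar transport (generic lemma) and the scalar `χ(L)⁻¹ = |det_Δ q|_v^{−n}`
  have key := map_eq_addEquivAddHaarChar_inv_smul_of_semiconj ψ hψmul L
    (fun u : unipDeltaLocal F E c v n (JD := JD) =>
      (⟨q * (u : UnitaryGroup.localPi E c (n + n) JD v) * q⁻¹, conj_mem_unipDeltaLocal F E c hcδ hδ hd v n hT₀ hJD hq u.2⟩ :
        unipDeltaLocal F E c v n (JD := JD))) (fun u => by rw [hLapply, ψ.symm_apply_apply, he]) νN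
  rw [key]
  ext s _
  rw [Measure.smul_apply, Measure.smul_apply, ENNReal.smul_def, smul_eq_mul, smul_eq_mul, ← hχ, ← NNReal.coe_inv,
    ENNReal.ofReal_coe_nnreal]

/-! ## §4 The local intertwining property, unconditional -/

include hT₀d in
/-- **THE LOCAL INTERTWINING PROPERTY `M_v(s) : I_v(s, χ_v) → I_v(−s, (χ_v ∘ c)⁻¹)`.**  Let `νN` be a Haar measure on `N_Δ(F_v)`, `χ_w, χ′_w : E_wˣ →* ℂˣ`
families with `χ′_w = (χ_{w′})⁻¹ ∘ c_w` whenever `c • w = w′` (for a Hecke character: `χ′ = (χ ∘ c)⁻¹`, ★ `HeckeCharacter.localComponent_galConj_inv_eq_comp`), and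
`f` a Siegel section of `I_v(s, χ_v)` (★ `IsLocalSiegelSection`).  Then the local intertwining integral `M_v f (h) = ∫_{N_Δ(F_v)} f(w_Δ u h) dνN(u)` (★
`localIntertwining`) is a Siegel section of `I_v(−s, χ′_v)`: `M_v f (p h) = χ′_v(det_Δ p)|det_Δ p|_v^{−s+n/2} M_v f (h)` for `p ∈ P_Δ(F_v)` — every rank `n`, every
finite place, no integrability hypothesis (★ Φ8a (A) `isLocalSiegelSection_localIntertwining_of_modulus` + the modulus §3).  This is the hypothesis `hM` of ★
`K2LiuLocalIntertwiningSphericalReduction.localIntertwining_eq_apply_one_mul` (with `s′ = −s`).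
[cite: Casselman1980, §3] [cite: HarrisKudlaSweet1996, §1 (1.15), §6 (6.14)] [cite: MoeglinWaldspurger1995, II.1.6] -/
theorem isLocalSiegelSection_localIntertwining
    [MeasurableSpace (unipDeltaLocal F E c v n (JD := JD))] [BorelSpace (unipDeltaLocal F E c v n (JD := JD))]
    (νN : Measure (unipDeltaLocal F E c v n (JD := JD))) [νN.IsHaarMeasure]
    (χv χv' : ∀ w : PlacesOver E v, (w.1.adicCompletion E)ˣ →* ℂˣ)
    (hχ' : ∀ (w w' : PlacesOver E v) (h : c • w.1 = w'.1),
      χv' w = (χv w')⁻¹.comp (Units.map (galAdicCompletionMap (L := E) c h : w.1.adicCompletion E →* w'.1.adicCompletion E)))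
    (s : ℂ) {φ : UnitaryGroup.localPi E c (n + n) JD v → ℂ} (hφ : IsLocalSiegelSection F E c hcδ hδ hd v n hT₀ hJD χv s φ) :
    IsLocalSiegelSection F E c hcδ hδ hd v n hT₀ hJD χv' (-s) (localIntertwining F E c v n hJD νN φ) :=
  isLocalSiegelSection_localIntertwining_of_modulus F E c hcδ hδ hd v n hT₀ hT₀d hJD νN
    (fun _ hq => map_conj_unipDeltaLocal_eq_smul F E c hcδ hδ hd v n hT₀ hT₀d hJD νN hq) χv χv' hχ' s hφ

end Summit.HodgeConjecture.HodgeConjecture.Cruxes.HLiu418.K2LiuUnipDeltaConjugationModulus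

end
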